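import Summits.Ventures.PercRepro.C041BlockMapCutVertex
import Summits.Ventures.PercRepro.C041BlockMapParallel
import Summits.Ventures.PercRepro.C041BlockMapHost4Tools

/-!
# ROW C-041 — LOCAL REDUCTIONS ON ARBITRARY HOSTS: a loop, a pair of parallel edges, a vertex of degree `≤ 1`
(p6, gen 37; the general forms of §18, §20, §39 of proofs/P6-TWOEXIT-LEAN.md, stated for a given host with the
feature, not for a construction)

For an unmarked host `Z` with exits `u` and anchor `a`: (LOOP) if `ℓ` is a loop, `Z` is isomorphic to the host with
`ℓ` deleted and a loop added, so `ConeHost (del Z ℓ) u a → ConeHost Z u a` (`coneHost_of_loop`); (PARALLEL) if `e ≠ e′`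
join the same two vertices, `Z` is isomorphic to the host with `e′` deleted and `e` doubled, so `Z` is a cone host as
soon as `del Z e′` and its contraction along `e` are (`coneHost_of_parallel`, THEOREM (PARALLEL EDGE) §20); (DEGREE
`≤ 1`) a vertex `x` with at most one incident edge gives a SEPARATION of `Z` at its neighbour (or at any vertex),
whose far side is a host on two vertices — a cone host for every family of exits (`coneHost_two_vertices`: every
family of exits on two vertices sits on the anchor and one other vertex) — so THEOREM (CUT VERTEX) reduces `Z` to the
host without `x`, with the neighbour as an extra exit (`coneHost_of_degree_le_one`); the case of the ANCHOR of degree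
`≤ 1` is the separation at `{a, x}` whose near side is the two-vertex host (`coneHost_of_anchor_degree_le_one`).
The induction «cores ⟹ all hosts» is `C041BlockMapCores`.
-/

namespace PercRepro

namespace ZoneZ

namespace MultiExit

open ZoneData Pendant Finset TwoExit TreeClosure

/-! ## Transport along an isomorphism, in `ConeHost` form -/

section Iso

variable {V₁ E₁ V₂ E₂ : Type} (Z₁ : ZoneData V₁ E₁ Empty Empty) (Z₂ : ZoneData V₂ E₂ Empty Empty)
  [Fintype E₁] [DecidableEq E₁] [Fintype E₂] [DecidableEq E₂]

omit [Fintype E₁] [DecidableEq E₁] [Fintype E₂] [DecidableEq E₂] in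
/-- The incidences correspond when the ends do. -/
theorem joins_iff_of_ends (fv : V₁ ≃ V₂) (fe : E₁ → E₂) (hf : ∀ e, Z₂.fst (fe e) = fv (Z₁.fst e))
    (hs : ∀ e, Z₂.snd (fe e) = fv (Z₁.snd e)) (e : E₁) (x y : V₁) :
    Z₂.Joins (fe e) (fv x) (fv y) ↔ Z₁.Joins e x y := by
  unfold ZoneData.Joins
  rw [hf, hs, fv.injective.eq_iff, fv.injective.eq_iff, fv.injective.eq_iff, fv.injective.eq_iff]

/-- `ConeHost` transported along an isomorphism of hosts. -/
theorem coneHost_of_iso (fv : V₁ ≃ V₂) (fe : E₁ ≃ E₂) (hJ : ∀ e x y, Z₂.Joins (fe e) (fv x) (fv y) ↔ Z₁.Joins e x y)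
    {ι : Type} [Fintype ι] (u : ι → V₁) (a : V₁) (h : ConeHost Z₁ u a) : ConeHost Z₂ (fv ∘ u) (fv a) := by
  intro w hw
  rw [blockMap_iso Z₁ Z₂ fv fe hJ]
  exact h w hw

/-- `ConeHost` transported back along an isomorphism of hosts. -/
theorem coneHost_of_iso' (fv : V₁ ≃ V₂) (fe : E₁ ≃ E₂)
    (hJ : ∀ e x y, Z₂.Joins (fe e) (fv x) (fv y) ↔ Z₁.Joins e x y) {ι : Type} [Fintype ι] (u : ι → V₂) (a : V₂)
    (h : ConeHost Z₁ (fv.symm ∘ u) (fv.symm a)) : ConeHost Z₂ u a := by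
  have h1 := coneHost_of_iso Z₁ Z₂ fv fe hJ _ _ h
  have hu : fv ∘ (fv.symm ∘ u) = u := by
    funext k
    simp only [Function.comp_apply, Equiv.apply_symm_apply]
  rw [hu, Equiv.apply_symm_apply] at h1
  exact h1

end Iso

section Local

variable {V E : Type} (Z : ZoneData V E Empty Empty) [DecidableEq V] [DecidableEq E] [Fintype E]

/-! ## A loop -/

omit [DecidableEq V] in
/-- **A LOOP**: a host with a loop `ℓ` is a cone host as soon as the host with `ℓ` deleted is. -/
theorem coneHost_of_loop (ℓ : E) (hℓ : Z.fst ℓ = Z.snd ℓ) {ι : Type} [Fintype ι] (u : ι → V) (a : V)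
    (h : ConeHost (del Z ℓ) u a) : ConeHost Z u a := by
  have h1 := coneHost_addLoop (del Z ℓ) u a h (Z.fst ℓ)
  refine coneHost_of_iso' (addLoop (del Z ℓ) (Z.fst ℓ)) Z (Equiv.refl V) (Equiv.optionSubtypeNe ℓ) ?_ u a h1
  intro e x y
  rcases e with _ | ⟨e, he⟩
  · rw [Equiv.optionSubtypeNe_none]
    show Z.Joins ℓ x y ↔ (Z.fst ℓ = x ∧ Z.fst ℓ = y) ∨ (Z.fst ℓ = y ∧ Z.fst ℓ = x)
    unfold ZoneData.Joins
    rw [hℓ]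
  · rw [Equiv.optionSubtypeNe_some]
    exact Iff.rfl

/-! ## Parallel edges -/

omit [DecidableEq V] [DecidableEq E] [Fintype E] in
/-- Two parallel edges have the same incidences. -/
theorem joins_of_parallel {e e' : E} (hpar : Z.Joins e' (Z.fst e) (Z.snd e)) (x y : V) :
    Z.Joins e' x y ↔ Z.Joins e x y := by
  unfold ZoneData.Joins at hpar ⊢
  rcases hpar with ⟨h1, h2⟩ | ⟨h1, h2⟩
  · rw [h1, h2]
  · rw [h1, h2]
    exact ⟨fun h => h.elim (fun h => Or.inr ⟨h.2, h.1⟩) fun h => Or.inl ⟨h.2, h.1⟩,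
      fun h => h.elim (fun h => Or.inr ⟨h.2, h.1⟩) fun h => Or.inl ⟨h.2, h.1⟩⟩

/-- **PARALLEL EDGES**: a host with two parallel edges `e ≠ e′` is a cone host as soon as the host with `e′` deleted
and its contraction along `e` are (THEOREM (PARALLEL EDGE)). -/
theorem coneHost_of_parallel (e e' : E) (hne : e ≠ e') (hpar : Z.Joins e' (Z.fst e) (Z.snd e)) {ι : Type}
    [Fintype ι] [DecidableEq ι] (u : ι → V) (a : V) (h₁ : ConeHost (del Z e') u a)
    (h₂ : ConeHost (contract (del Z e') (Z.fst e) (Z.snd e)) (fun k => redC (Z.fst e) (Z.snd e) (u k))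
      (redC (Z.fst e) (Z.snd e) a)) : ConeHost Z u a := by
  have hd : ConeHost (dup (del Z e') ⟨e, hne⟩) u a :=
    coneHost_of_built (Built.dup (del Z e') ⟨e, hne⟩ u a (Built.core _ _ _ h₁) (Built.core _ _ _ h₂))
  refine coneHost_of_iso' (dup (del Z e') ⟨e, hne⟩) Z (Equiv.refl V) (Equiv.optionSubtypeNe e') ?_ u a hd
  intro f x y
  rcases f with _ | ⟨f, hf⟩
  · rw [Equiv.optionSubtypeNe_none]
    exact joins_of_parallel Z hpar x y
  · rw [Equiv.optionSubtypeNe_some]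
    exact Iff.rfl

/-! ## Hosts on two vertices are cone hosts for every family of exits -/

/-- A host whose vertices are two, one of them the anchor, is a cone host for every family of exits. -/
theorem coneHost_two_vertices {V₂ E₂ : Type} (Z₂ : ZoneData V₂ E₂ Empty Empty) [Fintype E₂] [DecidableEq E₂]
    (a b : V₂) (hab : ∀ x, x = a ∨ x = b) {ι : Type} [Fintype ι] [DecidableEq ι] (u : ι → V₂) :
    ConeHost Z₂ u a :=
  coneHost_of_forall_eq_or_eq Z₂ a b u fun k => (hab (u k)).symm

/-! ## A vertex of degree `≤ 1` -/

/-- The host without the vertex `x` (`Aᶜ = {x}` in the separation at `x`'s neighbour). -/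
abbrev without (x : V) : ZoneData {y // y ≠ x} {e // InA Z (fun y => y ≠ x) e} Empty Empty :=
  sideA Z fun y => y ≠ x

/-- The far side of the separation at `p` with `Aᶜ = {x}`: its vertices are `none` (= `p`) and `some ⟨x, _⟩`. -/
theorem far_side_two_vertices (x : V) (y : Option {y // ¬ y ≠ x}) : y = none ∨ y = some ⟨x, fun h => h rfl⟩ := by
  rcases y with _ | ⟨y, hy⟩
  · exact Or.inl rfl
  · right
    congr
    exact Decidable.not_not.1 hy

/-- **A VERTEX OF DEGREE `≤ 1`**: if every edge at `x` joins it to `p` (at most one edge, to `p`), `x ≠ a`, `x ≠ p`,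
then `Z` is a cone host at `u` as soon as the host without `x` is one at the exits of `u` other than `x` with `p` as
an extra exit. -/
theorem coneHost_of_degree_le_one (x p a : V) (hxa : x ≠ a) (hxp : x ≠ p)
    (hx : ∀ e, Z.fst e = x ∨ Z.snd e = x → Z.Joins e p x) {ι : Type} [Fintype ι] [DecidableEq ι] (u : ι → V)
    (h : ConeHost (without Z x) (uplus (exitsA (fun y => y ≠ x) u) ⟨p, hxp.symm⟩) ⟨a, hxa.symm⟩) :
    ConeHost Z u a := by
  refine coneHost_of_sep Z (fun y => y ≠ x) p hxp.symm a hxa.symm ?_ u h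
    (coneHost_two_vertices (sideB Z fun y => y ≠ x) none (some ⟨x, fun h => h rfl⟩) (far_side_two_vertices x) _)
  intro e
  by_cases he : Z.fst e = x ∨ Z.snd e = x
  · right
    rcases hx e he with ⟨h1, h2⟩ | ⟨h1, h2⟩
    · exact ⟨Or.inr h1, Or.inl fun h => h h2⟩
    · exact ⟨Or.inl fun h => h h1, Or.inr h2⟩
  · left
    exact ⟨(not_or.1 he).1, (not_or.1 he).2⟩

/-- The host with the anchor `a` and a vertex `x` removed, anchored at `x` (the far side of the separation at `x`
with `A = {a, x}`). -/
abbrev withoutPair (a x : V) : ZoneData (Option {y // ¬ (y = a ∨ y = x)}) {e // ¬ InA Z (fun y => y = a ∨ y = x) e}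
    Empty Empty :=
  sideB Z fun y => y = a ∨ y = x

omit [DecidableEq V] in
/-- The near side of the separation at `{a, x}` has the two vertices `a` and `x`. -/
theorem near_side_two_vertices (a x : V) (y : {y // y = a ∨ y = x}) :
    y = ⟨a, Or.inl rfl⟩ ∨ y = ⟨x, Or.inr rfl⟩ := by
  obtain ⟨y, hy | hy⟩ := y
  · left
    congr
  · right
    congr

/-- **THE ANCHOR OF DEGREE `≤ 1`**: if every edge at the anchor joins it to `x`, then `Z` is a cone host at `u`
as soon as the host without `a` and `x`, anchored at `x`, is one at the exits of `u` outside `{a, x}`. -/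
theorem coneHost_of_anchor_degree_le_one (a x : V)
    (ha : ∀ e, Z.fst e = a ∨ Z.snd e = a → Z.Joins e a x) {ι : Type} [Fintype ι] [DecidableEq ι] (u : ι → V)
    (h : ConeHost (withoutPair Z a x) (exitsB (fun y => y = a ∨ y = x) u) none) : ConeHost Z u a := by
  refine coneHost_of_sep Z (fun y => y = a ∨ y = x) x (Or.inr rfl) a (Or.inl rfl) ?_ u
    (coneHost_two_vertices (sideA Z fun y => y = a ∨ y = x) ⟨a, Or.inl rfl⟩ ⟨x, Or.inr rfl⟩
      (near_side_two_vertices a x) _) h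
  intro e
  by_cases he : Z.fst e = a ∨ Z.snd e = a
  · left
    rcases ha e he with ⟨h1, h2⟩ | ⟨h1, h2⟩
    · exact ⟨Or.inl h1, Or.inr h2⟩
    · exact ⟨Or.inr h1, Or.inl h2⟩
  · right
    have he' := not_or.1 he
    constructor
    · by_cases hf : Z.fst e = x
      · exact Or.inr hf
      · left
        rintro (h1 | h1)
        · exact he'.1 h1
        · exact hf h1
    · by_cases hs : Z.snd e = x
      · exact Or.inr hs
      · left
        rintro (h1 | h1)
        · exact he'.2 h1
        · exact hs h1

end Local

end MultiExit

end ZoneZ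

end PercRepro
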